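import Summits.ABC.IUTFork.Cor312GenuineThetaIdentification
import Literature.IUT.LogVolume.GenuineLogThetaPerImageExactVolume
import HarnessLib

/-!
# [IUTchIII] Corollary 3.12 IN READING (P) — the GENUINE-SIDE IDENTIFICATION at the M level: the LAST-slot orbit-hull log-volumes of the
# M-LEVEL presentation ARE the summands of abc-iut-S7's per-image `−|log(Θ)|^{(P)}` (per-image twin of abc-iut-w5-d166's unit P6-ident)

PROOF-ONLY file (D-0012; no definitions, no `Prop` facts) of the abc-iut cell (branch C certificate seat abc-iut-C-cert-2 gen 4; the M-LEVEL SLOT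
READ, part 2/3). TAKES NO SIDE on [IUTchIII] Cor. 3.12 or on the reading (U)/(P) of `−|log(Θ)|`.

abc-iut-S7's PER-IMAGE `−|log(Θ)|^{(P)}` of a Θ-volume input `I` (`GenuineLogThetaPerImage`: [IUTchIII] Cor. 3.12 proof Step (x), kurims
`paper:url-4b091feeb646` p. 181 «the resulting log-volumes … one for each possible image»; Dupuy–Hilado §4.11–4.12 `U_Θ^slot`) is
`negLogThetaPerImageNonarch I = Σ_{p ∈ T(I)} negLogThetaPerImageLoc p`, `negLogThetaPerImageLoc p = (I.packetAt p).negLogThetaPerImageAt ℓ⋆ (I.tΘ p)` =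
`ln ν̄_{𝕃_p}` of the hull of the SLOT images (the (Ind2)-orbit of the ONE region `ι_j(t_{Θ,j,v_j})·(R_I)^∼`, NO factor permutation) over the
real prime packet of the GENUINE completions. abc-iut-w5-d166's `Cor312GenuineThetaIdentification` (p437565) identified the reading-(U) orbit-hull sums
of the M-level presentation (`presAtM`, carriers `kOfM x = K_{𝔭_{w(x)}}`, abc-iut-w5-d033's ideles `tThetaM`) with abc-iut-S2's `negLogThetaLoc p`
along the index identification `V̲_u ≅ V(F_mod)_p` (`fibreArrowEquiv`, `localFieldsM`, `tUnitsM`) and norm transport. THIS FILE is the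
reading-(P) twin, over the SAME data and by the SAME two steps:

* §1 TRANSPORT: `negLogThetaPerImageAt_ofPlaces_eq` — abc-iut-S7's `negLogThetaPerImageAt` over `realPrimePacketM (ofPlaces w hw)` depends only on
  the place map `w` and the NORMS of the ideles (abc-iut-w5-d156 `realPrimePacketWith_pilotRegion_eq_of_norm_eq`), hence
  **`negLogThetaPerImageAt_localFieldsM_eq_negLogThetaPerImageLoc`**: computed on the M-level carriers with `tUnitsM` it EQUALS
  `(volumeInputOf D r).negLogThetaPerImageLoc p`;
* §2 REINDEXING: `slotImagesHull_pilotRegion_localFieldsM` (abc-iut-s2-p2 `realPrimePacketWith_slotImages_pilotRegion_eq`: the slot-image hull at a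
  summand of degree `i+1` is the `(R_I)^∼`-hull of the (Ind2)-orbit of the LAST-slot box `ι_{i+1}(t_{Θ,i,v̲_{i+1}})·(R_I)^∼`),
  **`sum_fibre_weightM_lastSlotOrbitHull_eq_lnνTensorPower`** — the Pr-weighted sum over `v⃗' : S^±_{i+2} → V̲_u` of the normalised log-measures of
  these hulls (the right-hand side of this seat's `thetaSlotLocal_settingPrVolSharpM_eq_sum_orbitHull`, part 1/3) IS abc-iut-S7's
  `lnνTensorPower (i+1) (slotImagesHull (pilotRegion …))` over `localFieldsM`, and **`procAvg_sum_fibre_weightM_lastSlotOrbitHull_eq_negLogThetaPerImageLoc`**: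
  its procession average over `i` IS `(volumeInputOf D r).negLogThetaPerImageLoc p`.

So, with part 1/3 at the datum's own Θ-ideles, `(M-setting).negLogThetaSlot = ↑(volumeInputOf D r).negLogThetaPerImageNonarch` follows place by place
(part 3/3). [cite: Mochizuki2012, IUTchIII Cor. 3.12 p. 173–174, proof Step (x) p. 181] [cite: Mochizuki2012, IUTchI Def. 3.1 (e) p. 62]
[cite: DupuyHilado2025, Def. 3.6.1, Def. 3.6.3, §3.9, §4.9, §4.11–4.12] [claim: Mochizuki2012, status: disputed] for the quoted notions.
HONEST FRAMING: an identity between OUR two typings of the same per-image quantity; reading (P) is STRONGER than print's hull of the union of ALL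
possible images; nothing here bears on the truth of [IUTchIII] Cor. 3.12 or takes a side on any author; typed ≠ proved; instantiated ≠ endorsed.
-/

noncomputable section

open Set Function NumberField IsDedekindDomain
open scoped Pointwise

namespace Summit.ABC.IUTFork.Thm311.Real

open Cor312Vol Literature.IUT.LogThetaLattice Literature.IUT.LogVolume Literature.IUT.HodgeTheaters
  Literature.NumberTheory.NumberFields

/-! ## §1. Transport: `−|log(Θ)|^{(P)}_p` over a place family depends only on the place map and the norms of the ideles -/

section OfPlaces

variable {F₀ K : Type} [Field F₀] [NumberField F₀] [Field K] [NumberField K] (p : ℕ) [hp : Fact p.Prime]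

/-- **TRANSPORT, reading (P)**: abc-iut-S7's `−|log(Θ)|^{(P)}_p` over the real prime packet of a place family depends only on the place
map and on the NORMS of the ideles — equal place maps (pointwise) and ideles of equal norms give the same number (the pilot region only
sees the norms, abc-iut-w5-d156 `realPrimePacketWith_pilotRegion_eq_of_norm_eq`; the per-image number is a function of the pilot region).
The reading-(P) twin of abc-iut-w5-d166's `negLogThetaAt_ofPlaces_eq`. [cite: Mochizuki2012, IUTchIII Cor. 3.12 proof Step (x) p. 181]
[cite: DupuyHilado2025, §3.9, §4.11–4.12] -/
theorem negLogThetaPerImageAt_ofPlaces_eq {w w' : placesOver F₀ p → HeightOneSpectrum (𝓞 K)}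
    (hw : ∀ v, ((p : ℕ) : 𝓞 K) ∈ (w v).asIdeal) (hw' : ∀ v, ((p : ℕ) : 𝓞 K) ∈ (w' v).asIdeal)
    (h : ∀ v, w v = w' v) {lstar : ℕ}
    (t : Fin lstar → (v : placesOver F₀ p) → ((ofPlaces p w hw).k v)ˣ)
    (t' : Fin lstar → (v : placesOver F₀ p) → ((ofPlaces p w' hw').k v)ˣ)
    (hn : ∀ i v, ‖((t i v : ((ofPlaces p w hw).k v)ˣ) : (ofPlaces p w hw).k v)‖ =
      ‖((t' i v : ((ofPlaces p w' hw').k v)ˣ) : (ofPlaces p w' hw').k v)‖) :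
    (realPrimePacketM p (ofPlaces p w hw)).negLogThetaPerImageAt lstar t =
      (realPrimePacketM p (ofPlaces p w' hw')).negLogThetaPerImageAt lstar t' := by
  obtain rfl : w = w' := funext h
  unfold PrimePacket.negLogThetaPerImageAt realPrimePacketM
  rw [realPrimePacketWith_pilotRegion_eq_of_norm_eq p (ofPlaces p w hw) (mScale p (ofPlaces p w hw))
    (mScale_ne_zero p (ofPlaces p w hw)) (mScale_perm p (ofPlaces p w hw)) t t' hn]

end OfPlaces

variable {F K Fbar : Type} [Field F] [NumberField F] [Field K] [NumberField K] [Algebra F K]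
  [Field Fbar] [Algebra F Fbar] [Algebra K Fbar] {E : WeierstrassCurve F} [E.IsElliptic] {l : ℕ}
  {Pb : BadPlacePredicates K} (D : InitialThetaData F K Fbar E l Pb)
  (p : ℕ) [hp : Fact p.Prime] (u : FinitePlace ℚ) (hu : ((p : ℕ) : 𝓞 ℚ) ∈ (FinitePlace.maximalIdeal u).asIdeal)
  (r : ThetaData.IdeleData D)

/-- **`−|log(Θ)|^{(P)}_p` computed over the M-LEVEL carriers with the ideles read off `r` EQUALS abc-iut-S7's number over the genuine
completions at the section** (transport along `liftPlace D v = 𝔭_{w(v̲)}`, abc-iut-w5-d166 `liftPlace_eq_placeOfM_fibreOfPlaceOverM`, + norm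
invariance, `norm_tUnitsM`). [cite: Mochizuki2012, IUTchIII Cor. 3.12 proof Step (x) p. 181] -/
theorem negLogThetaPerImageAt_localFieldsM_eq :
    (realPrimePacketM p (localFieldsM D p u hu)).negLogThetaPerImageAt (thetaIndexOfInitial D).lstar (tUnitsM D p u hu r) =
      (realPrimePacketM p ((ThetaData.placeSection D).localFields p)).negLogThetaPerImageAt (ThetaData.pilotData D).lstar
        (r.tΘ p hp.out) := by
  exact negLogThetaPerImageAt_ofPlaces_eq p (w := fun v => placeOfM D u (fibreOfPlaceOverM D p u hu v))
    (w' := fun v => ThetaData.liftPlace D v.1) _ _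
    (fun v => (liftPlace_eq_placeOfM_fibreOfPlaceOverM D p u hu v).symm) (tUnitsM D p u hu r) (r.tΘ p hp.out)
    fun i v => norm_tUnitsM D p u hu r i v

/-- … and that number is the `p`-summand `negLogThetaPerImageLoc p` of the Θ-volume input `volumeInputOf D r`
(abc-iut-S7 `ThetaVolumeInput.negLogThetaPerImageLoc_of_prime`; `packetAt p = realPrimePacketM ((placeSection D).localFieldFamily p)`).
[cite: DupuyHilado2025, Def. 3.6.3, §4.11–4.12] -/
theorem negLogThetaPerImageAt_localFieldsM_eq_negLogThetaPerImageLoc :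
    (realPrimePacketM p (localFieldsM D p u hu)).negLogThetaPerImageAt (thetaIndexOfInitial D).lstar (tUnitsM D p u hu r) =
      (ThetaData.volumeInputOf D r).negLogThetaPerImageLoc p := by
  rw [negLogThetaPerImageAt_localFieldsM_eq, ThetaVolumeInput.negLogThetaPerImageLoc_of_prime _ hp.out]
  rfl

/-! ## §2. Reindexing the setting-side LAST-slot orbit-hull sum along `V̲_u ≅ V(F_mod)_p` -/

/-- **The hull of the SLOT images of the pilot region over `localFieldsM` at a summand of degree `i+1`, in LAST-slot form**: the
`(R_I)^∼`-hull of the (Ind2)-orbit of `ι_{i+1}(t_{Θ,i,v̲_{i+1}})·(R_I)^∼` with abc-iut-w5-d033's ideles (abc-iut-s2-p2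
`realPrimePacketWith_slotImages_pilotRegion_eq`). [cite: Mochizuki2012, IUTchIII Cor. 3.12 proof Step (x) p. 181] [cite: DupuyHilado2025, §3.9, §4.9, §4.12] -/
theorem slotImagesHull_pilotRegion_localFieldsM (i : Fin (thetaIndexOfInitial D).lstar)
    (e : Fin ((i : ℕ) + 1 + 1) → placesOver (fieldOfModuli E) p) :
    (realPrimePacketM p (localFieldsM D p u hu)).slotImagesHull
        ((realPrimePacketM p (localFieldsM D p u hu)).pilotRegion (tUnitsM D p u hu r)) ((i : ℕ) + 1) e =
      packetHull p (fun b => (localFieldsM D p u hu).k (e b))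
        (⋃ g : indTwo p (fun b => (localFieldsM D p u hu).k (e b)),
          g • iota p (fun b => (localFieldsM D p u hu).k (e b)) (Fin.last _)
              (tThetaM D p u hu r i (fibreOfPlaceOverM D p u hu (e (Fin.last _)))) •
            (normalizedPacket p (fun b => (localFieldsM D p u hu).k (e b)) :
              Set (PacketAlgebra p (fun b => (localFieldsM D p u hu).k (e b))))) := by
  unfold PrimePacket.slotImagesHull realPrimePacketM
  rw [realPrimePacketWith_slotImages_pilotRegion_eq]
  rfl

/-- **One summand**: at `v⃗' = fibreOfPlaceOverM ∘ v⃗` the M-side LAST-slot term — Pr-weight times the normalised log-measure of the hull of the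
(Ind2)-orbit of the last-slot box of abc-iut-w5-d033's Θ-ideles — IS abc-iut-S7's summand `log μ̄(hull of the slot images of the pilot region)·Π_a Pr(v_a)`
over `localFieldsM` at `v⃗` (carriers agree DEFINITIONALLY; weights by abc-iut-w5-d166 `weightM_fibreOfPlaceOverM_comp`; the region by
`slotImagesHull_pilotRegion_localFieldsM`). [cite: DupuyHilado2025, Def. 3.6.3, §4.12] -/
theorem weightM_mul_lastSlotOrbitHull_fibreOf_eq (i : Fin (thetaIndexOfInitial D).lstar)
    (e : Fin ((i : ℕ) + 1 + 1) → placesOver (fieldOfModuli E) p) :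
    weightM D u (Fin.succ i) (fun a => fibreOfPlaceOverM D p u hu (e a)) *
        packetLogμ p (fun b => kOfM D p u hu (fibreOfPlaceOverM D p u hu (e b)))
          (packetHull p (fun b => kOfM D p u hu (fibreOfPlaceOverM D p u hu (e b)))
            (⋃ g : indTwo p (fun b => kOfM D p u hu (fibreOfPlaceOverM D p u hu (e b))),
              g • iota p (fun b => kOfM D p u hu (fibreOfPlaceOverM D p u hu (e b))) (Fin.last _)
                    (tThetaM D p u hu r i (fibreOfPlaceOverM D p u hu (e (Fin.last _)))) •
                  (normalizedPacket p (fun b => kOfM D p u hu (fibreOfPlaceOverM D p u hu (e b))) :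
                    Set (PacketAlgebra p (fun b => kOfM D p u hu (fibreOfPlaceOverM D p u hu (e b))))))) =
      (realPrimePacketM p (localFieldsM D p u hu)).logμ
          ((realPrimePacketM p (localFieldsM D p u hu)).slotImagesHull
            ((realPrimePacketM p (localFieldsM D p u hu)).pilotRegion (tUnitsM D p u hu r)) ((i : ℕ) + 1) e) *
        ∏ a, weight (fieldOfModuli E) (e a).1 := by
  rw [slotImagesHull_pilotRegion_localFieldsM, weightM_fibreOfPlaceOverM_comp, mul_comm]
  rfl

/-- **REINDEXING, reading (P)**: the Pr-weighted sum over `v⃗' : S^±_{i+2} → V̲_u` of the normalised log-measures of the hulls of the (Ind2)-orbits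
of the LAST-slot boxes of abc-iut-w5-d033's Θ-ideles — the right-hand side of this seat's `thetaSlotLocal_settingPrVolSharpM_eq_sum_orbitHull`
(`Cor312ThetaSlotM`, part 1/3) at abc-iut-w5-d166's presentation — IS abc-iut-S7's `lnνTensorPower (i+1)` of the hull of the slot images of the
pilot region over `localFieldsM` (`Fintype.sum_equiv` along abc-iut-w5-d166's `fibreArrowEquiv`, then `weightM_mul_lastSlotOrbitHull_fibreOf_eq`).
The reading-(P) twin of `sum_fibre_weightM_orbitHull_eq_lnνTensorPower`. [cite: DupuyHilado2025, Def. 3.6.3, §4.12] -/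
theorem sum_fibre_weightM_lastSlotOrbitHull_eq_lnνTensorPower [Fintype ((thetaIndexOfInitial D).Fibre (Val.non u))]
    (i : Fin (thetaIndexOfInitial D).lstar) :
    (∑ e' : Fin ((i : ℕ) + 1 + 1) → (thetaIndexOfInitial D).Fibre (Val.non u),
      weightM D u (Fin.succ i) e' *
        packetLogμ p (fun b => kOfM D p u hu (e' b))
          (packetHull p (fun b => kOfM D p u hu (e' b))
            (⋃ g : indTwo p (fun b => kOfM D p u hu (e' b)),
              g • iota p (fun b => kOfM D p u hu (e' b)) (Fin.last _) (tThetaM D p u hu r i (e' (Fin.last _))) •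
                (normalizedPacket p (fun b => kOfM D p u hu (e' b)) :
                  Set (PacketAlgebra p (fun b => kOfM D p u hu (e' b))))))) =
      (realPrimePacketM p (localFieldsM D p u hu)).lnνTensorPower ((i : ℕ) + 1)
        ((realPrimePacketM p (localFieldsM D p u hu)).slotImagesHull
          ((realPrimePacketM p (localFieldsM D p u hu)).pilotRegion (tUnitsM D p u hu r))) := by
  unfold PrimePacket.lnνTensorPower
  symm
  refine Fintype.sum_equiv ((fibreArrowEquiv D p u hu ((i : ℕ) + 1 + 1)).symm) _ _ fun e => ?_
  exact (weightM_mul_lastSlotOrbitHull_fibreOf_eq D p u hu r i e).symm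

/-- **The procession average of the setting-side LAST-slot orbit-hull sums IS the `p`-summand of abc-iut-S7's per-image `−|log(Θ)|^{(P)}`**:
`(1/ℓ⋆)·Σ_i [the sum of `sum_fibre_weightM_lastSlotOrbitHull_eq_lnνTensorPower`] = (volumeInputOf D r).negLogThetaPerImageLoc p` — the GENUINE-SIDE
identification of the M-level slot READ at the prime `p` (then §1). The reading-(P) twin of abc-iut-w5-d166's
`procAvg_sum_fibre_weightM_orbitHull_eq_negLogThetaLoc`. [cite: Mochizuki2012, IUTchIII Cor. 3.12 proof Step (x) p. 181] [cite: DupuyHilado2025, Def. 3.6.3, §4.12] -/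
theorem procAvg_sum_fibre_weightM_lastSlotOrbitHull_eq_negLogThetaPerImageLoc [Fintype ((thetaIndexOfInitial D).Fibre (Val.non u))] :
    (1 / ((thetaIndexOfInitial D).lstar : ℝ)) * ∑ i : Fin (thetaIndexOfInitial D).lstar,
      (∑ e' : Fin ((i : ℕ) + 1 + 1) → (thetaIndexOfInitial D).Fibre (Val.non u),
        weightM D u (Fin.succ i) e' *
          packetLogμ p (fun b => kOfM D p u hu (e' b))
            (packetHull p (fun b => kOfM D p u hu (e' b))
              (⋃ g : indTwo p (fun b => kOfM D p u hu (e' b)),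
                g • iota p (fun b => kOfM D p u hu (e' b)) (Fin.last _) (tThetaM D p u hu r i (e' (Fin.last _))) •
                  (normalizedPacket p (fun b => kOfM D p u hu (e' b)) :
                    Set (PacketAlgebra p (fun b => kOfM D p u hu (e' b))))))) =
      (ThetaData.volumeInputOf D r).negLogThetaPerImageLoc p := by
  rw [← negLogThetaPerImageAt_localFieldsM_eq_negLogThetaPerImageLoc D p u hu r]
  unfold PrimePacket.negLogThetaPerImageAt PrimePacket.lnνLp
  congr 1
  exact Finset.sum_congr rfl fun i _ => sum_fibre_weightM_lastSlotOrbitHull_eq_lnνTensorPower D p u hu r i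

end Summit.ABC.IUTFork.Thm311.Real

end
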